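import Summits.BirchSwinnertonDyer.Rank1Residual.GaloisImage.KummerSubgroupEquiv
import HarnessLib

/-!
# `μₙ(k̄) ≃ Eˣ[n]` as `Γ_k`-modules when `μₙ ⊆ E`
# (cell `b2b-bsdres`, team n1011, row T-EPC = Tate's local Euler–Poincaré characteristic; seat p04 GEN 8; stage C4d)

HONEST FRAMING (cell `b2b-bsdres`, run/shared/lean/b2b/bsd-rank1-residual/, verbatim in every
file): the goal of the cell is to DELETE the COMBINATION-SHAPED residual classes of the
Birch–Swinnerton-Dyer formula for ALL analytic-rank `≤ 1` elliptic curves over `ℚ` — "full BSD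
formula for every rank `≤ 1` curve in class `C`" assembled STRICTLY from published theorems — so
that the rank-`≤ 1` remainder becomes exactly the CONSTRUCTION-SHAPED classes, which are TYPED
(missing-input `Prop`s), NOT attempted. This is not "finishing BSD". Team n1011 (N10 / N11, the
additive block X4 ∧ `p = 3`): research route; no claim beyond the stated classes; nothing is
booked; no mark / label is changed by this file. Theorems only (no definition, no named fact, no
`sorry`); TOOL theorems of Galois theory.  (Placement: Summits/GaloisImage with the T-EPC cone.)

## What

For `k` of characteristic `0`, `n`, and a normal subextension `E ⊆ k̄` whose fixing group
`Gal(k̄/E)` acts trivially on `μₙ(k̄)`: the roots of unity lie in `E` (Galois correspondence) and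
`ζ ↦ ζ` is an isomorphism of `Γ_k`-modules between the tree's `μₙ = DiscreteGaloisModule.mu k n` and
the `n`-torsion `Eˣ[n]` of the `Gal(E/k)`-module `Eˣ` of stages B1–B7 (the subrepresentation
`ker (n : Additive Eˣ → Additive Eˣ)` of `Representation.ofMulDistribMulAction (E ≃ₐ[k] E) Eˣ`),
pulled back to `Γ_k` along `resGal E`:

* `KummerSubgroup.muVal_mem` — `μₙ(k̄) ⊆ E`;
* `KummerSubgroup.nonempty_equiv_mu_torsionUnits` — the equivalence of representations.

This identifies the factor `#Hom_Δ(Z, Eˣ[p])` of Milne's Lemma 2.11 (stage B7) with `#Hom_Γ(Z, μ_p)`.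

References: J. S. Milne, *Arithmetic Duality Theorems* (2006), I §2 proof of Thm. 2.8
[MilneADT2006]; J.-P. Serre, *Local Fields* (1979), X §3 [SerreLocalFields1979].
-/

noncomputable section

open Function Field
open Literature.NumberTheory.GaloisRepresentations
open Literature.NumberTheory.GaloisRepresentations.DiscreteGaloisModule
open Literature.NumberTheory.GaloisRepresentations.LocalWeilDatum (galFixing mem_galFixing_iff)

universe u

namespace Summit.BirchSwinnertonDyer.Rank1Residual.GaloisImage

namespace KummerSubgroup

variable (k : Type u) [Field k] (n : ℕ) (E : IntermediateField k (AlgebraicClosure k))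

/-- **`μₙ(k̄) ⊆ E`** when `Gal(k̄/E)` fixes `μₙ(k̄)` (characteristic `0`, Galois correspondence).
[folklore] -/
theorem muVal_mem [CharZero k] (hμ : ∀ g ∈ galFixing k E, ∀ ζ : MuCarrier k n, mu k n g ζ = ζ)
    (ζ : MuCarrier k n) : ((muVal k n ζ : (AlgebraicClosure k)ˣ) : AlgebraicClosure k) ∈ E := by
  rw [← forall_smul_eq_iff_mem]
  intro g hg
  have h := congrArg (fun v => ((muVal k n v : (AlgebraicClosure k)ˣ) : AlgebraicClosure k)) (hμ g hg ζ)
  simp only [muVal_apply, Units.coe_smul] at h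
  exact h

/-- The unit of `E` underlying a root of unity, and its properties (value, `n`-torsion).
[folklore] -/
theorem exists_units_of_mu [CharZero k] (hμ : ∀ g ∈ galFixing k E, ∀ ζ : MuCarrier k n, mu k n g ζ = ζ) :
    ∃ ι : MuCarrier k n →+ Additive (↥E)ˣ,
      (∀ ζ, (((Additive.toMul (ι ζ) : (↥E)ˣ) : E) : AlgebraicClosure k) = muVal k n ζ) ∧
      Injective ι ∧
      (∀ ζ, ι ζ ∈ LinearMap.ker (LinearMap.lsmul ℤ (Additive (↥E)ˣ) n)) ∧
      (∀ x ∈ LinearMap.ker (LinearMap.lsmul ℤ (Additive (↥E)ˣ) n), ∃ ζ, ι ζ = x) := by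
  have hne : ∀ ζ : MuCarrier k n, (⟨_, muVal_mem k n E hμ ζ⟩ : E) ≠ 0 := fun ζ h =>
    Units.ne_zero (muVal k n ζ) (congrArg (fun z : E => (z : AlgebraicClosure k)) h)
  let u : MuCarrier k n → (↥E)ˣ := fun ζ => Units.mk0 _ (hne ζ)
  have hu : ∀ ζ, (((u ζ : (↥E)ˣ) : E) : AlgebraicClosure k) = muVal k n ζ := fun ζ => rfl
  have hu_inj : ∀ ζ ζ', u ζ = u ζ' → ζ = ζ' := fun ζ ζ' h =>
    muVal_injective k n (Units.ext (by rw [← hu, ← hu, h]))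
  have hu_mul : ∀ ζ ζ', u (ζ + ζ') = u ζ * u ζ' := fun ζ ζ' =>
    Units.ext (Subtype.ext (by
      change (((u (ζ + ζ') : (↥E)ˣ) : E) : AlgebraicClosure k) = ((u ζ : E) : AlgebraicClosure k) * ((u ζ' : E) : AlgebraicClosure k)
      rw [hu, hu, hu, muVal_add, Units.val_mul]))
  let ι : MuCarrier k n →+ Additive (↥E)ˣ :=
    { toFun := fun ζ => Additive.ofMul (u ζ)
      map_zero' := by
        have h : u 0 = 1 := Units.ext (Subtype.ext (by
          rw [hu, muVal_zero, Units.val_one]; rfl))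
        rw [h]; rfl
      map_add' := fun ζ ζ' => by rw [hu_mul]; rfl }
  have hι : ∀ ζ, Additive.toMul (ι ζ) = u ζ := fun ζ => rfl
  refine ⟨ι, fun ζ => hu ζ, fun ζ ζ' h => hu_inj ζ ζ' (by rw [← hι, ← hι, h]), fun ζ => ?_, fun x hx => ?_⟩
  · rw [LinearMap.mem_ker, LinearMap.lsmul_apply, natCast_zsmul]
    change Additive.ofMul ((u ζ) ^ n) = Additive.ofMul 1
    refine congrArg Additive.ofMul (Units.ext (Subtype.ext ?_))
    rw [Units.val_pow_eq_pow_val, IntermediateField.coe_pow, hu, ← Units.val_pow_eq_pow_val, muVal_pow_eq_one,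
      Units.val_one]
    rfl
  · rw [LinearMap.mem_ker, LinearMap.lsmul_apply, natCast_zsmul] at hx
    have hxn : (Additive.toMul x) ^ n = 1 := by
      rw [← toMul_nsmul, hx, toMul_zero]
    -- the root of unity in `k̄`
    have hval : (Units.map (algebraMap (↥E) (AlgebraicClosure k)).toMonoidHom (Additive.toMul x)) ^ n = 1 := by
      rw [← map_pow, hxn, map_one]
    let ζ : rootsOfUnity n (AlgebraicClosure k) := ⟨_, (mem_rootsOfUnity _ _).2 hval⟩
    refine ⟨MuCarrier.ofRootsOfUnity ζ, ?_⟩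
    change Additive.ofMul (u (MuCarrier.ofRootsOfUnity ζ)) = x
    rw [← ofMul_toMul x]
    refine congrArg Additive.ofMul (Units.ext (Subtype.ext ?_))
    rw [hu, muVal_ofRootsOfUnity]
    rfl

/-- **`μₙ(k̄) ≃ Eˣ[n]` as `Γ_k`-representations** (`E/k` normal inside `k̄`, `Gal(k̄/E)` fixing
`μₙ(k̄)`, characteristic `0`): `ζ ↦ ζ ∈ Eˣ` identifies the tree's Galois module `μₙ` with the
`n`-torsion subrepresentation of `Additive Eˣ` under `Gal(E/k)`, pulled back along `Γ_k → Gal(E/k)`.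
[cite: MilneADT2006, I §2 proof of Thm 2.8 (p. 34)] [cite: SerreLocalFields1979, X §3] -/
theorem nonempty_equiv_mu_torsionUnits [CharZero k] [Normal k E]
    (hμ : ∀ g ∈ galFixing k E, ∀ ζ : MuCarrier k n, mu k n g ζ = ζ) :
    Nonempty ((mu k n).toRepresentation.Equiv
      ((((Representation.ofMulDistribMulAction (↥E ≃ₐ[k] ↥E) (↥E)ˣ).subrepresentation _
          (ModPRepCount.ker_lsmul_le_comap
            (Representation.ofMulDistribMulAction (↥E ≃ₐ[k] ↥E) (↥E)ˣ) n))).comp (resGal E))) := by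
  classical
  set ρU := Representation.ofMulDistribMulAction (↥E ≃ₐ[k] ↥E) (↥E)ˣ with hρU
  set T := LinearMap.ker (LinearMap.lsmul ℤ (Additive (↥E)ˣ) n) with hT
  obtain ⟨ι, hιval, hιinj, hιmem, hιsurj⟩ := exists_units_of_mu k n E hμ
  -- the bijection onto `T`
  let e₀ : MuCarrier k n → T := fun ζ => ⟨ι ζ, hιmem ζ⟩
  have he₀ : ∀ ζ, ((e₀ ζ : T) : Additive (↥E)ˣ) = ι ζ := fun ζ => rfl
  have hbij : Bijective e₀ := by
    refine ⟨fun ζ ζ' h => hιinj (by rw [← he₀, ← he₀, h]), fun x => ?_⟩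
    obtain ⟨ζ, hζ⟩ := hιsurj x.1 x.2
    exact ⟨ζ, Subtype.ext hζ⟩
  let e₁ := Equiv.ofBijective e₀ hbij
  have he₁ : ∀ ζ, ((e₁ ζ : T) : Additive (↥E)ˣ) = ι ζ := fun ζ => rfl
  have hadd : ∀ ζ ζ', e₁ (ζ + ζ') = e₁ ζ + e₁ ζ' := fun ζ ζ' =>
    Subtype.ext (by rw [Submodule.coe_add, he₁, he₁, he₁, map_add])
  -- equivariance on values in `k̄`
  have hequiv : ∀ (g : absoluteGaloisGroup k) (ζ : MuCarrier k n),
      e₁ ((mu k n) g ζ) = (ρU.subrepresentation T (ModPRepCount.ker_lsmul_le_comap ρU n)) (resGal E g) (e₁ ζ) := by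
    intro g ζ
    apply Subtype.ext
    rw [he₁, Representation.subrepresentation_apply]
    change ι ((mu k n) g ζ) = ρU (resGal E g) (ι ζ)
    rw [hρU, Representation.ofMulDistribMulAction_apply_apply, ← ofMul_toMul (ι ((mu k n) g ζ))]
    refine congrArg Additive.ofMul (Units.ext (Subtype.ext ?_))
    rw [hιval, coe_resGal_smul_units, hιval, muVal_apply, Units.coe_smul]
  refine ⟨Representation.Equiv.mk
    { toFun := e₁
      invFun := e₁.symm
      map_add' := hadd
      map_smul' := fun c ζ => ?_
      left_inv := e₁.symm_apply_apply
      right_inv := e₁.apply_symm_apply } fun g => LinearMap.ext fun ζ => hequiv g ζ⟩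
  -- `ℤ`-linearity from additivity
  have h := map_zsmul (AddMonoidHom.mk' e₁ hadd) c ζ
  change e₁ (c • ζ) = c • e₁ ζ
  exact h

end KummerSubgroup

end Summit.BirchSwinnertonDyer.Rank1Residual.GaloisImage

end
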